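import Literature.Analysis.FluidPDE.GallayWayneProfileExistence
import Literature.Analysis.FluidPDE.BurgersPhiTemperate
import Literature.Analysis.Distribution.SchwartzMultipliers
import Mathlib.Analysis.SpecialFunctions.Trigonometric.DerivHyp
import Mathlib.MeasureTheory.Integral.ExpDecay
import HarnessLib

/-!
# The Gallay–Wayne cell weight and the stream coefficient of `w_∞`

The radial data of Gallay–Wayne 2006, Prop. 3.1, in the variable `t = r²`: the weight
`h(r) = (r²/4)/(e^{r²/4} − 1)` of (3.5) is `h̃(t) = 1/φ(−t/4)` (`φ = burgersPhi`,
`φ(s) = (1 − e^{−s})/s`), and the stream coefficient `E` (`= 2Ω(r)/r²` with `Ω` from (3.4)) is a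
bounded solution on `[0, ∞)` of

  `E(t) = ⅛ ( t⁻² ∫₀ᵗ u² h̃(u)(E(u) − ½) du + ∫ₜ^∞ h̃(u)(E(u) − ½) du )`,

the vorticity profile being `a = h̃ (E − ½)` (`w_∞(x) = x₀x₁ a(|x|²)`; (3.5) reads `ω = h(Ω − r²/4)`).
This file constructs `E` WITH TEMPERATE GROWTH ON `ℝ` (`exists_gallayWayne_streamCoeff`), by
applying the contraction theorem `exists_cellFixedPoint` to the cut-off weight
`ĥ(t) = χ(t) h̃(t)`, `χ(t) = smoothTransition(20t + 2)` (`= 1` on `[−1/20, ∞)`, `= 0` on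
`(−∞, −1/10]`), whose mass function is `≤ ∫₀^∞ h̃ + 2·(1/10)·2 ≤ 15/2 + 2/5 < 8`:

* `hasTemperateGrowth_cellWeight`, `cellWeight_nonneg`, `cellWeight_eq_of_le` (`ĥ = h̃` on
  `[−1/20, ∞)`), `cellWeight_eq_zero` (`t ≤ −1/10`), `cellWeight_le_two` (`[−1/10, 0]`);
* `inv_burgersPhi_neg_le_exp_neg`: `h̃(t) ≤ e^{−t/8}` (`t ≥ 0`; i.e. `y ≤ sinh y`);
* `inv_burgersPhi_neg_le_majorant`: `h̃(t) ≤ (1 + t/4)e^{−t/4} − (t/8)e^{−t/2}` (`t ≥ 0`; from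
  `eᶻ ≥ 1 + z + z²/2 + z³/6`), whence `∫₀^∞ h̃ ≤ 15/2` (`integral_Ioi_inv_burgersPhi_neg_le`; the
  exact value is `4ζ(2) = 2π²/3`);
* `exists_gallayWayne_streamCoeff`.

Everything is proved; no definitions, no named facts.

## References

* Th. Gallay, C. E. Wayne, *Existence and stability of asymmetric Burgers vortices*, J. Math.
  Fluid Mech. 9 (2007) = arXiv:math/0503353, §3, (3.2)–(3.9), Prop. 3.1. [GallayWayne2006]
-/

noncomputable section

open Set Filter MeasureTheory intervalIntegral
open scoped Topology

namespace Literature.Analysis.FluidPDE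

/-! ### The weight `h̃(t) = 1/φ(−t/4)` on `[0, ∞)` -/

/-- **`h̃(t) = 1/φ(−t/4) ≤ e^{−t/8}` for `t ≥ 0`** (equivalently `y ≤ sinh y`, `y = t/8`). [folklore] -/
theorem inv_burgersPhi_neg_le_exp_neg {t : ℝ} (ht : 0 ≤ t) :
    (burgersPhi (-(t / 4)))⁻¹ ≤ Real.exp (-(t / 8)) := by
  rcases ht.eq_or_lt with rfl | ht'
  · simp
  · have hs : -(t / 4) ≠ 0 := by linarith
    rw [burgersPhi_of_ne_zero hs, neg_neg, inv_div]
    -- `-(t/4) / (1 - e^{t/4}) ≤ e^{-t/8}`, i.e. `(t/4) e^{t/8} ≤ e^{t/4} - 1`... via `y ≤ sinh y`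
    set y := t / 8 with hy
    have hy0 : 0 ≤ y := by positivity
    have hsinh : y ≤ Real.sinh y := Real.self_le_sinh_iff.2 hy0
    rw [Real.sinh_eq] at hsinh
    have h4 : t / 4 = 2 * y := by rw [hy]; ring
    have hE : Real.exp (t / 4) = Real.exp y * Real.exp y := by rw [← Real.exp_add, h4]; ring_nf
    have hneg : Real.exp (-(t / 8)) = (Real.exp y)⁻¹ := by rw [← Real.exp_neg, hy]
    have hy' : Real.exp (-y) = (Real.exp y)⁻¹ := Real.exp_neg y
    have hey : 0 < Real.exp y := Real.exp_pos y
    have hden : 1 - Real.exp (t / 4) < 0 := by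
      have : 1 < Real.exp (t / 4) := Real.one_lt_exp_iff.2 (by positivity)
      linarith
    rw [div_le_iff_of_neg hden, hE, hneg, h4]
    rw [hy'] at hsinh
    have hXX : (Real.exp y)⁻¹ * Real.exp y = 1 := inv_mul_cancel₀ hey.ne'
    have h2 : 2 * y * Real.exp y ≤ Real.exp y * Real.exp y - 1 := by
      have h3 := mul_le_mul_of_nonneg_right hsinh hey.le
      have e : (Real.exp y - (Real.exp y)⁻¹) / 2 * Real.exp y =
          (Real.exp y * Real.exp y - 1) / 2 := by
        rw [sub_div, sub_mul, div_mul_eq_mul_div, div_mul_eq_mul_div, hXX]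
        ring
      rw [e] at h3
      linarith
    rw [inv_mul_le_iff₀ hey]
    linarith

/-- **`h̃(t) ≤ (1 + t/4)e^{−t/4} − (t/8)e^{−t/2}` for `t ≥ 0`** (`h̃(t) = (t/4)/(e^{t/4} − 1)`;
the inequality reduces, with `z = t/4`, `X = eᶻ`, to `X² − (1 + 3z/2)X + z/2 ≥ 0`, which holds
because `X ≥ 1 + z + z²/2 + z³/6`). [folklore] -/
theorem inv_burgersPhi_neg_le_majorant {t : ℝ} (ht : 0 ≤ t) :
    (burgersPhi (-(t / 4)))⁻¹ ≤
      (1 + t / 4) * Real.exp (-(t / 4)) - t / 8 * Real.exp (-(t / 2)) := by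
  rcases ht.eq_or_lt with rfl | ht'
  · simp
  · set z := t / 4 with hz
    have hz0 : 0 < z := by positivity
    have hs : -z ≠ 0 := by linarith
    have hX1 : 1 < Real.exp z := Real.one_lt_exp_iff.2 hz0
    set X := Real.exp z with hX
    have hXpos : 0 < X := Real.exp_pos z
    -- Taylor lower bound of order three
    have hP : 1 + z + z ^ 2 / 2 + z ^ 3 / 6 ≤ X := by
      have h := Real.sum_le_exp_of_nonneg hz0.le 4
      simp only [Finset.sum_range_succ, Finset.sum_range_zero, Nat.factorial, pow_zero, pow_one,
        Nat.cast_one, zero_add] at h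
      norm_num at h
      rw [hX]
      linarith
    have hQ : 0 ≤ X ^ 2 - (1 + 3 * z / 2) * X + z / 2 := by
      nlinarith [mul_nonneg (sub_nonneg.2 hP) (by nlinarith : 0 ≤ X + (1 + z + z ^ 2 / 2 + z ^ 3 / 6) - (1 + 3 * z / 2)),
        pow_nonneg hz0.le 3, pow_nonneg hz0.le 4, pow_nonneg hz0.le 5, pow_nonneg hz0.le 6]
    -- rewrite everything in terms of `X`
    have ht4 : t / 4 = z := hz.symm
    have ht8 : t / 8 = z / 2 := by rw [hz]; ring
    have ht2 : t / 2 = 2 * z := by rw [hz]; ring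
    have he1 : Real.exp (-z) = X⁻¹ := by rw [Real.exp_neg]
    have he2 : Real.exp (-(2 * z)) = (X ^ 2)⁻¹ := by
      rw [Real.exp_neg, pow_two, ← Real.exp_add]; ring_nf
    rw [burgersPhi_of_ne_zero hs, neg_neg, inv_div, ht8, ht2, he1, he2, ← hX]
    rw [show -z / (1 - X) = z / (X - 1) by rw [neg_div, ← div_neg, neg_sub]]
    have hX1' : 0 < X - 1 := by linarith
    rw [div_le_iff₀ hX1']
    have key : ((1 + z) * X⁻¹ - z / 2 * (X ^ 2)⁻¹) * (X - 1) =
        (X ^ 2 - (1 + 3 * z / 2) * X + z / 2) / X ^ 2 + z := by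
      field_simp
      ring
    rw [key]
    have : 0 ≤ (X ^ 2 - (1 + 3 * z / 2) * X + z / 2) / X ^ 2 := div_nonneg hQ (by positivity)
    linarith

/-- `h̃ ≥ 0`. [folklore] -/
theorem inv_burgersPhi_neg_nonneg (t : ℝ) : 0 ≤ (burgersPhi (-(t / 4)))⁻¹ :=
  (inv_pos.2 (burgersPhi_pos _)).le

/-- **`∫₀^∞ h̃ ≤ 15/2`** (the majorant `(1 + t/4)e^{−t/4} − (t/8)e^{−t/2}` is the derivative of
`F(t) = −(8 + t)e^{−t/4} + (t/4 + ½)e^{−t/2}`, `F(0) = −15/2`, `F(∞) = 0`). [folklore] -/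
theorem integral_Ioi_inv_burgersPhi_neg_le :
    IntegrableOn (fun t => (burgersPhi (-(t / 4)))⁻¹) (Ioi 0) ∧
      ∫ t in Ioi (0 : ℝ), (burgersPhi (-(t / 4)))⁻¹ ≤ 15 / 2 := by
  set F : ℝ → ℝ := fun t => -(8 + t) * Real.exp (-(t / 4)) + (t / 4 + 1 / 2) * Real.exp (-(t / 2))
    with hF
  set M : ℝ → ℝ := fun t => (1 + t / 4) * Real.exp (-(t / 4)) - t / 8 * Real.exp (-(t / 2)) with hM
  have hderiv : ∀ t, HasDerivAt F (M t) t := by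
    intro t
    have h1 : HasDerivAt (fun t => Real.exp (-(t / 4))) (Real.exp (-(t / 4)) * -(1 / 4)) t :=
      ((hasDerivAt_id' t).div_const 4).fun_neg.exp
    have h2 : HasDerivAt (fun t => Real.exp (-(t / 2))) (Real.exp (-(t / 2)) * -(1 / 2)) t :=
      ((hasDerivAt_id' t).div_const 2).fun_neg.exp
    have h3 : HasDerivAt (fun t => -(8 + t)) (-1) t := ((hasDerivAt_id' t).const_add 8).fun_neg
    have h4 : HasDerivAt (fun t => t / 4 + 1 / 2) (1 / 4) t :=
      ((hasDerivAt_id' t).div_const 4).add_const (1 / 2)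
    have h := (h3.fun_mul h1).fun_add (h4.fun_mul h2)
    refine h.congr_deriv ?_
    simp only [hM]
    ring
  have hcont : Continuous F := by simp only [hF]; fun_prop
  have hlim : Tendsto F atTop (𝓝 0) := by
    have e4 : Tendsto (fun t : ℝ => Real.exp (-(t / 4))) atTop (𝓝 0) := by
      have := Real.tendsto_exp_neg_atTop_nhds_zero.comp
        (tendsto_id.atTop_div_const (by norm_num : (0 : ℝ) < 4))
      exact this
    have e2 : Tendsto (fun t : ℝ => Real.exp (-(t / 2))) atTop (𝓝 0) := by
      have := Real.tendsto_exp_neg_atTop_nhds_zero.comp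
        (tendsto_id.atTop_div_const (by norm_num : (0 : ℝ) < 2))
      exact this
    have p4 : Tendsto (fun t : ℝ => t / 4 * Real.exp (-(t / 4))) atTop (𝓝 0) := by
      have := (Real.tendsto_pow_mul_exp_neg_atTop_nhds_zero 1).comp
        (tendsto_id.atTop_div_const (by norm_num : (0 : ℝ) < 4))
      simpa [Function.comp_def] using this
    have p2 : Tendsto (fun t : ℝ => t / 2 * Real.exp (-(t / 2))) atTop (𝓝 0) := by
      have := (Real.tendsto_pow_mul_exp_neg_atTop_nhds_zero 1).comp
        (tendsto_id.atTop_div_const (by norm_num : (0 : ℝ) < 2))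
      simpa [Function.comp_def] using this
    have hfun : F = fun t => -(8 * Real.exp (-(t / 4))) - 4 * (t / 4 * Real.exp (-(t / 4))) +
        (1 / 2) * (t / 2 * Real.exp (-(t / 2))) + 1 / 2 * Real.exp (-(t / 2)) := by
      funext t; simp only [hF]; ring
    rw [hfun]
    have := (((e4.const_mul 8).neg.sub (p4.const_mul 4)).add (p2.const_mul (1 / 2))).add
      (e2.const_mul (1 / 2))
    simpa using this
  have hMnn : ∀ t ∈ Ioi (0 : ℝ), 0 ≤ M t := fun t ht =>
    (inv_burgersPhi_neg_nonneg t).trans (inv_burgersPhi_neg_le_majorant (le_of_lt ht))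
  have hMint : IntegrableOn M (Ioi 0) :=
    integrableOn_Ioi_deriv_of_nonneg hcont.continuousWithinAt (fun t _ => hderiv t) hMnn hlim
  have hMval : ∫ t in Ioi (0 : ℝ), M t = 15 / 2 := by
    rw [integral_Ioi_of_hasDerivAt_of_tendsto hcont.continuousWithinAt (fun t _ => hderiv t) hMint hlim]
    simp only [hF]
    norm_num
  have hcontw : Continuous fun t : ℝ => (burgersPhi (-(t / 4)))⁻¹ :=
    (contDiff_inv_burgersPhi (n := 0)).continuous.comp (by fun_prop)
  have hint : IntegrableOn (fun t => (burgersPhi (-(t / 4)))⁻¹) (Ioi 0) := by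
    refine hMint.mono' hcontw.aestronglyMeasurable.restrict
      ((ae_restrict_iff' measurableSet_Ioi).2 (Eventually.of_forall fun t ht => ?_))
    rw [Real.norm_eq_abs, abs_of_nonneg (inv_burgersPhi_neg_nonneg t)]
    exact inv_burgersPhi_neg_le_majorant (le_of_lt ht)
  refine ⟨hint, ?_⟩
  rw [← hMval]
  exact setIntegral_mono_on hint hMint measurableSet_Ioi fun t ht =>
    inv_burgersPhi_neg_le_majorant (le_of_lt ht)

/-! ### The cut-off weight `ĥ(t) = χ(t) h̃(t)`, `χ(t) = smoothTransition(20t + 2)` -/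

/-- `ĥ = h̃` on `[−1/20, ∞)`. [folklore] -/
theorem cellWeight_eq_of_le {t : ℝ} (ht : -(1 / 20) ≤ t) :
    Real.smoothTransition (20 * t + 2) * (burgersPhi (-(t / 4)))⁻¹ = (burgersPhi (-(t / 4)))⁻¹ := by
  rw [Real.smoothTransition.one_of_one_le (by linarith), one_mul]

/-- `ĥ = 0` on `(−∞, −1/10]`. [folklore] -/
theorem cellWeight_eq_zero {t : ℝ} (ht : t ≤ -(1 / 10)) :
    Real.smoothTransition (20 * t + 2) * (burgersPhi (-(t / 4)))⁻¹ = 0 := by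
  rw [Real.smoothTransition.zero_of_nonpos (by linarith), zero_mul]

/-- `0 ≤ ĥ`. [folklore] -/
theorem cellWeight_nonneg (t : ℝ) :
    0 ≤ Real.smoothTransition (20 * t + 2) * (burgersPhi (-(t / 4)))⁻¹ :=
  mul_nonneg (Real.smoothTransition.nonneg _) (inv_burgersPhi_neg_nonneg t)

/-- `ĥ ≤ 2` on `(−∞, 0]` (there `h̃(t) = 1/φ(s)`, `s = −t/4 ≥ 0`, and `1/φ(s) ≤ 1 + s`; we only
need `t ≥ −4`). [folklore] -/
theorem cellWeight_le_two {t : ℝ} (ht1 : -4 ≤ t) (ht : t ≤ 0) :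
    Real.smoothTransition (20 * t + 2) * (burgersPhi (-(t / 4)))⁻¹ ≤ 2 := by
  have hs : 0 ≤ -(t / 4) := by linarith
  have h1 : (burgersPhi (-(t / 4)))⁻¹ ≤ 1 + -(t / 4) :=
    (inv_le_iff_one_le_mul₀ (burgersPhi_pos _)).2 (one_le_one_add_mul_burgersPhi hs)
  calc Real.smoothTransition (20 * t + 2) * (burgersPhi (-(t / 4)))⁻¹
      ≤ 1 * (1 + -(t / 4)) :=
        mul_le_mul (Real.smoothTransition.le_one _) h1 (inv_burgersPhi_neg_nonneg t) zero_le_one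
    _ ≤ 2 := by linarith

/-- `ĥ(t) ≤ 2e^{−t/8}` for `t > −1/10`. [folklore] -/
theorem cellWeight_le_exp {t : ℝ} (ht : -(1 / 10) < t) :
    Real.smoothTransition (20 * t + 2) * (burgersPhi (-(t / 4)))⁻¹ ≤ 2 * Real.exp (-(t / 8)) := by
  rcases le_or_gt 0 t with h0 | h0
  · calc Real.smoothTransition (20 * t + 2) * (burgersPhi (-(t / 4)))⁻¹
        ≤ 1 * Real.exp (-(t / 8)) := mul_le_mul (Real.smoothTransition.le_one _)
          (inv_burgersPhi_neg_le_exp_neg h0) (inv_burgersPhi_neg_nonneg t) zero_le_one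
      _ ≤ 2 * Real.exp (-(t / 8)) := by gcongr; norm_num
  · have h1 := cellWeight_le_two (by linarith) h0.le
    have h2 : 1 ≤ Real.exp (-(t / 8)) := Real.one_le_exp_iff.2 (by linarith)
    nlinarith

/-- **`ĥ` is integrable on `ℝ`.** [folklore] -/
theorem integrable_cellWeight :
    Integrable fun t => Real.smoothTransition (20 * t + 2) * (burgersPhi (-(t / 4)))⁻¹ := by
  have hcont : Continuous fun t : ℝ => Real.smoothTransition (20 * t + 2) * (burgersPhi (-(t / 4)))⁻¹ :=
    (Real.smoothTransition.continuous.comp (by fun_prop)).mul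
      ((contDiff_inv_burgersPhi (n := 0)).continuous.comp (by fun_prop))
  have hi : IntegrableOn (fun t : ℝ => 2 * Real.exp (-(1 / 8) * t)) (Ioi (-(1 / 10))) :=
    (exp_neg_integrableOn_Ioi (-(1 / 10)) (by norm_num : (0 : ℝ) < 1 / 8)).const_mul 2
  have hg : Integrable ((Ioi (-(1 / 10) : ℝ)).indicator fun t => 2 * Real.exp (-(1 / 8) * t)) :=
    hi.integrable_indicator measurableSet_Ioi
  refine hg.mono' hcont.aestronglyMeasurable (Eventually.of_forall fun t => ?_)
  rw [Real.norm_eq_abs, abs_of_nonneg (cellWeight_nonneg t)]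
  by_cases ht : -(1 / 10) < t
  · rw [indicator_of_mem (mem_Ioi.2 ht)]
    have := cellWeight_le_exp ht
    calc _ ≤ 2 * Real.exp (-(t / 8)) := this
      _ = 2 * Real.exp (-(1 / 8) * t) := by ring_nf
  · rw [indicator_of_notMem (fun h => ht (mem_Ioi.1 h)), cellWeight_eq_zero (not_lt.1 ht)]

/-- **`ĥ` has temperate growth.** [folklore] -/
theorem hasTemperateGrowth_cellWeight :
    Function.HasTemperateGrowth fun t => Real.smoothTransition (20 * t + 2) * (burgersPhi (-(t / 4)))⁻¹ := by
  have h1 : Function.HasTemperateGrowth fun t : ℝ => Real.smoothTransition (20 * t + 2) := by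
    have ha : Function.HasTemperateGrowth fun t : ℝ => 20 * t + 2 :=
      ((Function.HasTemperateGrowth.const 20).mul Function.HasTemperateGrowth.id').add
        (Function.HasTemperateGrowth.const 2)
    exact Distribution.hasTemperateGrowth_smoothTransition.comp ha
  have h2 : Function.HasTemperateGrowth fun t : ℝ => (burgersPhi (-(t / 4)))⁻¹ := by
    have ha : Function.HasTemperateGrowth fun t : ℝ => -(t / 4) := by
      have : (fun t : ℝ => -(t / 4)) = fun t => (-(1 / 4) : ℝ) * t := by funext t; ring
      rw [this]
      exact (Function.HasTemperateGrowth.const _).mul Function.HasTemperateGrowth.id'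
    exact hasTemperateGrowth_inv_burgersPhi.comp ha
  exact h1.mul h2

/-- **The mass function of `ĥ` is at most `79/10 < 8`.** [folklore] -/
theorem mass_cellWeight_le (t : ℝ) :
    |∫ u in (0 : ℝ)..t, Real.smoothTransition (20 * u + 2) * (burgersPhi (-(u / 4)))⁻¹| +
      ∫ u in Ioi t, Real.smoothTransition (20 * u + 2) * (burgersPhi (-(u / 4)))⁻¹ ≤ 79 / 10 := by
  have hI : ∫ u in Ioi (0 : ℝ), Real.smoothTransition (20 * u + 2) * (burgersPhi (-(u / 4)))⁻¹ ≤ 15 / 2 := by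
    rw [setIntegral_congr_fun measurableSet_Ioi (fun (u : ℝ) (hu : u ∈ Ioi (0 : ℝ)) =>
      cellWeight_eq_of_le (by rw [mem_Ioi] at hu; linarith))]
    exact integral_Ioi_inv_burgersPhi_neg_le.2
  have h := mass_le_of_support_of_le cellWeight_nonneg integrable_cellWeight
    (δ := 1 / 10) (M := 2) (I := 15 / 2) (by norm_num) (by norm_num)
    (fun u hu => cellWeight_eq_zero (by linarith)) (fun u hu hu0 => cellWeight_le_two (by linarith) hu0)
    hI t
  linarith

/-! ### The stream coefficient -/

/-- **The stream coefficient of `w_∞` (Gallay–Wayne 2006, Prop. 3.1, the function `2Ω(r)/r²` in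
the variable `t = r²`)**: there is a function `E : ℝ → ℝ` of temperate growth, bounded, which on
`[0, ∞)` solves `E(t) = ⅛ (t⁻² ∫₀ᵗ u² a(u) du + ∫ₜ^∞ a(u) du)` with the vorticity profile
`a = h̃ (E − ½)`, `h̃(u) = 1/φ(−u/4) = (u/4)/(e^{u/4} − 1)` ((3.5): `ω = h(Ω − r²/4)`; (3.9)).
[cite: GallayWayne2006, Prop. 3.1] -/
theorem exists_gallayWayne_streamCoeff :
    ∃ E : ℝ → ℝ, E.HasTemperateGrowth ∧ (∃ B, ∀ t, |E t| ≤ B) ∧ ∀ t, 0 ≤ t →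
      E t = 1 / 8 * ((t ^ 2)⁻¹ * (∫ u in (0 : ℝ)..t, u ^ 2 * ((burgersPhi (-(u / 4)))⁻¹ * (E u - 1 / 2))) +
        ∫ u in Ioi t, (burgersPhi (-(u / 4)))⁻¹ * (E u - 1 / 2)) := by
  have hcont : Continuous fun t : ℝ => Real.smoothTransition (20 * t + 2) * (burgersPhi (-(t / 4)))⁻¹ :=
    hasTemperateGrowth_cellWeight.1.continuous
  obtain ⟨E, hEc, ⟨B, hB⟩, hfix⟩ := exists_cellFixedPoint hcont cellWeight_nonneg integrable_cellWeight
    (L := 79 / 10) (by norm_num) mass_cellWeight_le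
  refine ⟨E, hasTemperateGrowth_of_cellFixedPoint hasTemperateGrowth_cellWeight integrable_cellWeight
    hEc hB hfix, ⟨B, hB⟩, fun t ht => ?_⟩
  rw [hfix t]
  congr 2
  · rcases ht.eq_or_lt with rfl | ht'
    · simp
    · rw [Calculus.mul_integral_pow_mul_comp_mul
        (g := fun u => Real.smoothTransition (20 * u + 2) * (burgersPhi (-(u / 4)))⁻¹ * (E u - 1 / 2))
        ht'.ne' 2]
      congr 1
      refine intervalIntegral.integral_congr fun u hu => ?_
      rw [uIcc_of_le ht] at hu
      rw [cellWeight_eq_of_le (by linarith [hu.1])]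
  · refine setIntegral_congr_fun measurableSet_Ioi fun u (hu : t < u) => ?_
    rw [cellWeight_eq_of_le (by linarith)]

end Literature.Analysis.FluidPDE
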